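import Summits.BirchSwinnertonDyer.BirchSwinnertonDyer.Theorems.ResidualThetaTransportAtTwoHeckeThetaPartnerAdicAtTwoTypeOneGrossencharakter
import Literature.NumberTheory.QuadraticFields.DiscriminantCharacter
import Literature.NumberTheory.QuadraticFields.SquareRootGenerator
import Literature.NumberTheory.QuadraticFields.HeegnerCondition
import Mathlib.NumberTheory.NumberField.InfinitePlace.TotallyRealComplex
import Mathlib.NumberTheory.NumberField.Units.Basic
import HarnessLib

/-!
# The unit character `λ` of an imaginary quadratic field modulo a rational integer

Route `ResidualThetaTransportAtTwo`, crux K0⁺ `HeckeThetaPartnerAdicAtTwo` (stmt-BirchSwinnertonDyer-20690),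
helper §E1′ of the line "proof from print" (input `λ` of `exists_isGrossencharakter_embType`, E1).
THEOREMS ONLY (no definition, no named fact, no `sorry`).

**Main result** `exists_unitCharacter`: for an imaginary quadratic field `k` (`[k:ℚ] = 2`, totally
complex) with a square root `δ` of an integer `Δ`, an embedding `σ : k → ℂ`, and a non-zero integer
`t` with `d_k ∣ t` and `|t| ≥ 3`, there is a character `λ` of `(𝓞 k/(t))ˣ` with `λ(ū) σ(u) = 1` for
every unit `u` of `𝓞 k` and `λ(n̄) = (d_k/n)` (Kronecker symbol, the tree's `discrChar`) for every
integer `n` prime to `t`.  Ingredients: units of `k` have `|σ(u)| = 1` (product formula at the unique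
infinite place); a unit congruent to a rational integer mod `(t)` is `±1` (conjugation: `u - ū ∈ (t)`,
`ū = u⁻¹`, so `u² ≡ 1`, and `|t| ≥ 3` forces `u² = 1`); `χ_{d_k}(-1) = -1`; Baer extension
(`exists_monoidHom_comp_eq`, `Subgroup.exists_monoidHom_extension_eq_one`).
-/

set_option autoImplicit false
set_option linter.dupNamespace false

noncomputable section

open scoped NumberField ComplexConjugate
open NumberField IsDedekindDomain Module
open Literature.NumberTheory.GaloisRepresentations Literature.NumberTheory.LFunctions
  Literature.NumberTheory.QuadraticFields.Quadratic

namespace Summit.BirchSwinnertonDyer.BirchSwinnertonDyer.Theorems.HeckeThetaPartner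

variable {k : Type} [Field k] [NumberField k]

/-- A rational integer divides another inside `𝓞 k` only if it does so in `ℤ` (`[k:ℚ] = 2`: take
norms, `t² ∣ n²`). [folklore] -/
theorem int_dvd_of_coe_dvd (hk : finrank ℚ k = 2) {t n : ℤ} (h : (t : 𝓞 k) ∣ (n : 𝓞 k)) : t ∣ n := by
  have h2 : finrank ℤ (𝓞 k) = 2 := by rw [RingOfIntegers.rank, hk]
  have := map_dvd (Algebra.norm ℤ) h
  rw [show (t : 𝓞 k) = algebraMap ℤ (𝓞 k) t from rfl, show (n : 𝓞 k) = algebraMap ℤ (𝓞 k) n from rfl,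
    Algebra.norm_algebraMap, Algebra.norm_algebraMap, h2] at this
  exact (Int.pow_dvd_pow_iff two_ne_zero).mp this

/-- **`‖σ x‖² = |N(x)|` in an imaginary quadratic field** (product formula: `k` has a single infinite
place, of multiplicity `2`). [folklore] -/
theorem norm_embedding_sq_eq_abs_norm (hk : finrank ℚ k = 2) [IsTotallyComplex k] (σ : k →+* ℂ)
    (x : k) : ‖σ x‖ ^ 2 = |(Algebra.norm ℚ x : ℚ)| := by
  classical
  have hr : InfinitePlace.nrRealPlaces k = 0 := (NumberField.nrRealPlaces_eq_zero_iff).mpr inferInstance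
  have hc : InfinitePlace.nrComplexPlaces k = 1 := by
    have h := InfinitePlace.card_add_two_mul_card_eq_rank k
    rw [hk, hr] at h
    omega
  have hcard : Fintype.card (InfinitePlace k) = 1 := by
    rw [InfinitePlace.card_eq_nrRealPlaces_add_nrComplexPlaces, hr, hc]
  set w₀ : InfinitePlace k := InfinitePlace.mk σ
  have hall : ∀ w : InfinitePlace k, w = w₀ := fun w => Fintype.card_le_one_iff.mp hcard.le w w₀
  have hprod := InfinitePlace.prod_eq_abs_norm x
  rw [Fintype.prod_eq_single w₀ (fun w hw => absurd (hall w) hw),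
    InfinitePlace.mult_isComplex ⟨w₀, IsTotallyComplex.isComplex w₀⟩,
    show w₀ x = ‖σ x‖ from InfinitePlace.apply σ _] at hprod
  rw [hprod]

/-- Units of an imaginary quadratic field have absolute value `1` under every embedding. [folklore] -/
theorem norm_embedding_unit_eq_one (hk : finrank ℚ k = 2) [IsTotallyComplex k] (σ : k →+* ℂ)
    (u : (𝓞 k)ˣ) : ‖σ ((u : 𝓞 k) : k)‖ = 1 := by
  have h := norm_embedding_sq_eq_abs_norm hk σ ((u : 𝓞 k) : k)
  rw [NumberField.Units.norm] at h
  have h0 : 0 ≤ ‖σ ((u : 𝓞 k) : k)‖ := norm_nonneg _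
  have h1 : ‖σ ((u : 𝓞 k) : k)‖ ^ 2 = 1 := by exact_mod_cast h
  nlinarith [h1, h0]

/-- A non-zero integer of an imaginary quadratic field has absolute value `≥ 1` under every embedding
(`‖σ x‖² = |N x| ≥ 1`). [folklore] -/
theorem one_le_norm_embedding (hk : finrank ℚ k = 2) [IsTotallyComplex k] (σ : k →+* ℂ)
    {x : 𝓞 k} (hx : x ≠ 0) : 1 ≤ ‖σ (x : k)‖ := by
  have h := norm_embedding_sq_eq_abs_norm hk σ (x : k)
  rw [← Algebra.coe_norm_int] at h
  have hN : Algebra.norm ℤ x ≠ 0 := Algebra.norm_ne_zero_iff.mpr hx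
  have h1 : (1 : ℝ) ≤ |((Algebra.norm ℤ x : ℤ) : ℚ)| := by
    rw [← Int.cast_abs]; exact_mod_cast Int.one_le_abs hN
  have h2 : (1 : ℝ) ≤ ‖σ (x : k)‖ ^ 2 := by rw [h]; exact_mod_cast h1
  nlinarith [norm_nonneg (σ (x : k)), h2]

/-- **No unit `≠ 1` is `≡ 1 mod (t)` for `|t| ≥ 3`** in an imaginary quadratic field (`u - 1 = t x`
with `‖σ u - 1‖ ≤ 2 < 3 ≤ |t| ‖σ x‖` unless `x = 0`). [folklore] -/
theorem unit_eq_one_of_sub_one_mem (hk : finrank ℚ k = 2) [IsTotallyComplex k] (σ : k →+* ℂ)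
    {t : ℤ} (ht : 3 ≤ |t|) {u : (𝓞 k)ˣ} (hu : (u : 𝓞 k) - 1 ∈ Ideal.span {(t : 𝓞 k)}) : u = 1 := by
  obtain ⟨x, hx⟩ := Ideal.mem_span_singleton'.mp hu
  by_cases hx0 : x = 0
  · rw [hx0, zero_mul, eq_comm, sub_eq_zero] at hx
    exact Units.ext hx
  exfalso
  have h1 := one_le_norm_embedding hk σ hx0
  have hu1 := norm_embedding_unit_eq_one hk σ u
  have hk' : (((u : 𝓞 k) : k) - 1) = (x : k) * (t : k) := by
    have := congrArg (fun y : 𝓞 k => (y : k)) hx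
    push_cast at this ⊢
    rw [← this]; norm_cast
  have h2 : ‖σ (((u : 𝓞 k) : k) - 1)‖ ≤ 2 := by
    rw [map_sub, map_one]
    calc ‖σ ((u : 𝓞 k) : k) - 1‖ ≤ ‖σ ((u : 𝓞 k) : k)‖ + ‖(1 : ℂ)‖ := norm_sub_le _ _
      _ = 2 := by rw [hu1, norm_one]; norm_num
  rw [hk', map_mul, norm_mul, map_intCast, Complex.norm_intCast] at h2
  have h3 : (3 : ℝ) ≤ |(t : ℝ)| := by exact_mod_cast ht
  nlinarith [h1, h2, h3, norm_nonneg (σ (x : k)), abs_nonneg (t : ℝ)]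

/-- **A unit congruent to a rational integer modulo `(t)`, `|t| ≥ 3`, is `±1`** (imaginary quadratic
`k = ℚ(δ)`, `δ² = Δ < 0`): conjugating, `u - ū ∈ (t)` with `ū = u⁻¹`, so `u² ≡ 1 mod (t)` and `u² = 1`.
[folklore] -/
theorem unit_sq_eq_one_of_sub_intCast_mem (hk : finrank ℚ k = 2) [IsTotallyComplex k] (σ : k →+* ℂ)
    {δ : 𝓞 k} {Δ : ℤ} (hΔ : Δ < 0) (hδ : (δ : k) ^ 2 = (Δ : k)) {t : ℤ} (ht : 3 ≤ |t|)
    {u : (𝓞 k)ˣ} {n : ℤ} (h : (u : 𝓞 k) - n ∈ Ideal.span {(t : 𝓞 k)}) : u = 1 ∨ u = -1 := by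
  -- the conjugation of `k = ℚ(δ)`
  have hθ : (δ : k) ∉ Set.range (algebraMap ℚ k) := by
    rintro ⟨r, hr⟩
    have h1 : (algebraMap ℚ k r) ^ 2 = algebraMap ℚ k (Δ : ℚ) := by rw [hr, hδ, map_intCast]
    rw [← map_pow] at h1
    have h2 : r ^ 2 = Δ := by exact_mod_cast (algebraMap ℚ k).injective h1
    nlinarith [sq_nonneg r, h2, (show (Δ : ℚ) < 0 by exact_mod_cast hΔ)]
  have hc : (δ : k) ^ 2 = algebraMap ℚ k (Δ : ℚ) := by rw [hδ, map_intCast]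
  set c := Literature.NumberTheory.QuadraticFields.Quadratic.conj hk hθ hc with hcdef
  -- `σ ∘ c = conj ∘ σ`
  have hσδ : conj (σ (δ : k)) = -σ (δ : k) := by
    set z := σ (δ : k) with hz
    have hz2 : z ^ 2 = (Δ : ℂ) := by rw [hz, ← map_pow, hδ]; simp
    have hre : z.re = 0 := by
      have him : (z ^ 2).im = 0 := by rw [hz2]; simp
      have hre2 : (z ^ 2).re = (Δ : ℝ) := by rw [hz2]; simp
      rw [sq, Complex.mul_im] at him
      rw [sq, Complex.mul_re] at hre2
      by_contra hne
      have h2 : z.re * z.im = 0 := by linarith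
      have : z.im = 0 := by
        rcases mul_eq_zero.mp h2 with h | h
        · exact absurd h hne
        · exact h
      rw [this, mul_zero, sub_zero] at hre2
      nlinarith [hre2, sq_nonneg z.re, (show (Δ : ℝ) < 0 by exact_mod_cast hΔ)]
    apply Complex.ext <;> simp [hre]
  have hσc : ∀ y : k, σ (c y) = conj (σ y) := by
    intro y
    obtain ⟨a, b, rfl⟩ := exists_eq_add_mul hk hθ y
    rw [hcdef, conj_add_mul]
    simp only [map_sub, map_add, map_mul, eq_ratCast, map_ratCast, hσδ]
    ring
  -- `u · c(u) = 1`
  have hu1 := norm_embedding_unit_eq_one hk σ u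
  have hucu : ((u : 𝓞 k) : k) * c ((u : 𝓞 k) : k) = 1 := by
    apply σ.injective
    rw [map_mul, hσc, map_one, Complex.mul_conj, Complex.normSq_eq_norm_sq, hu1]
    norm_num
  -- `u - n = x t`, hence `u² - 1 = u (x - c x) t`
  obtain ⟨x, hx⟩ := Ideal.mem_span_singleton'.mp h
  have hxk : ((u : 𝓞 k) : k) - n = (x : k) * (t : k) := by
    have h0 := congrArg (fun y : 𝓞 k => (y : k)) hx
    simp only [map_mul, map_sub, map_intCast] at h0
    linear_combination -h0
  have hcx : IsIntegral ℤ (c (x : k)) := map_isIntegral_int c.toRingHom x.2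
  set y : 𝓞 k := ⟨c (x : k), hcx⟩ with hy
  have hyk : ((y : 𝓞 k) : k) = c (x : k) := rfl
  have hkey : ((u : 𝓞 k) : k) * ((u : 𝓞 k) : k) - 1 =
      (((u : 𝓞 k) : k) * ((x : k) - c (x : k))) * (t : k) := by
    have h1 : c (((u : 𝓞 k) : k)) - n = c (x : k) * (t : k) := by
      have := congrArg c hxk
      rw [map_sub, map_mul] at this
      simpa using this
    linear_combination (((u : 𝓞 k) : k)) * hxk - (((u : 𝓞 k) : k)) * h1 + hucu
  have hmem : ((u * u : (𝓞 k)ˣ) : 𝓞 k) - 1 ∈ Ideal.span {(t : 𝓞 k)} := by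
    refine Ideal.mem_span_singleton'.mpr ⟨(u : 𝓞 k) * (x - y), ?_⟩
    apply NumberField.RingOfIntegers.coe_injective
    push_cast
    have hyk' : (algebraMap (𝓞 k) k) y = c (x : k) := rfl
    simp only [map_intCast, hyk']
    linear_combination -hkey
  have hsq : u * u = 1 := unit_eq_one_of_sub_one_mem hk σ ht hmem
  have hsq' : (u : 𝓞 k) * (u : 𝓞 k) = 1 := by
    have := congrArg Units.val hsq
    rwa [Units.val_mul, Units.val_one] at this
  rcases mul_self_eq_one_iff.mp hsq' with h1 | h1
  · exact Or.inl (Units.ext h1)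
  · exact Or.inr (Units.ext h1)

/-- Extension of two compatible characters from subgroups `P`, `W` of an abelian group to the whole
group (`ℂˣ`-valued; Baer twice: extend from `P`, then correct on `W` trivially on `P`). [folklore] -/
theorem exists_monoidHom_extension_pair {G : Type*} [CommGroup G] (P W : Subgroup G)
    (φP : P →* ℂˣ) (φW : W →* ℂˣ)
    (hcompat : ∀ (w : W) (hp : (w : G) ∈ P), φW w = φP ⟨w, hp⟩) :
    ∃ Φ : G →* ℂˣ, (∀ p : P, Φ p = φP p) ∧ ∀ w : W, Φ w = φW w := by
  obtain ⟨Φ₁, hΦ₁⟩ := Subgroup.exists_monoidHom_extension complexUnits_exists_pow_eq P φP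
  let μW : W →* ℂˣ :=
    { toFun := fun w => φW w * (Φ₁ w)⁻¹
      map_one' := by simp
      map_mul' := fun a b => by
        simp only [map_mul, Subgroup.coe_mul, mul_inv]
        simp only [mul_assoc, mul_comm, mul_left_comm] }
  obtain ⟨μ, hμP, hμW⟩ := Subgroup.exists_monoidHom_extension_eq_one complexUnits_exists_pow_eq P W μW
    (fun w hp => by
      change φW w * (Φ₁ w)⁻¹ = 1
      rw [hcompat w hp, ← hΦ₁ ⟨w, hp⟩, mul_inv_cancel])
  refine ⟨Φ₁ * μ, fun q => ?_, fun w => ?_⟩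
  · rw [MonoidHom.mul_apply, hμP _ q.2, mul_one, hΦ₁]
  · rw [MonoidHom.mul_apply, hμW]
    change Φ₁ w * (φW w * (Φ₁ w)⁻¹) = φW w
    rw [mul_comm (φW w), ← mul_assoc, mul_inv_cancel, one_mul]

end Summit.BirchSwinnertonDyer.BirchSwinnertonDyer.Theorems.HeckeThetaPartner

end
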